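import Summits.Langlands.Langlands.Theorems.PicardMuOrdinaryMuOrdinaryFamilyRTThorneCompanionsDebts
import Summits.Langlands.Langlands.Theorems.PicardMuOrdinaryMuOrdinaryFamilyRTThorneRbarAdequate
import Literature.NumberTheory.Automorphic.ReciprocityGLnPatchingFamily
import HarnessLib

/-!
# Crux `MuOrdinaryFamilyRT` (stmt-Langlands-13757), line `thorne-minimal-lift`:
# lemmas for G1 `Missing.auxiliaryCMField` — criteria for the auxiliary CM field (helper `auxiliaryField_criteria`)

G1 (…ThorneCompanionsDebts § 3, stub `stub_auxiliaryCMField`) asks for a number field `F'`, Galois over `ℚ`,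
CM, quadratic over `K = ℚ(ζ₃)`, over which the heart `r̄_f^B` keeps its image, with `F'/F'⁺` unramified at
every finite place (`UnramifiedOverMaximalReal`) and every place above `3` moved by complex conjugation
(`ThreeSplitFromMaximalReal`).  This file proves the CRITERIA that the witness `F' = K(√-p) = ℚ(ζ₃, √-p)`,
`p ≡ 2 (mod 3)` prime (companion file …ThorneAuxiliaryField), will satisfy:

* § 1 two generators with coprime discriminants kill the relative different: if `E = F(x) = F(s)` with
  `x² + x + 1 = 0`, `s² = -p`, `3 ∣ p + 1`, then `2x + 1, 2s ∈ 𝔇(𝓞 E/𝓞 F)` (Mathlib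
  `aeval_derivative_mem_differentIdeal`), so a prime dividing `𝔇` contains `3` and `4p`, i.e. `1`:
  **every prime of `E` is unramified over `F`** (`isUnramifiedAt_of_two_generators`);
* § 2 for a CM field `F'` whose integers contain such `x`, `s`: `UnramifiedOverMaximalReal F'` (§ 1 over
  `F'⁺`: neither generator is real, so each generates `F'/F'⁺`) and `ThreeSplitFromMaximalReal F'`
  (`s² ≡ 1 (mod w)` for `w ∣ 3`, so `s - 1 ∈ w` or `s + 1 ∈ w`; complex conjugation sends `s ↦ -s`, so
  `c • w = w` would put both, hence `2`, hence `1 = 3 - 2`, in `w`); packaged as the registered helper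
  `auxiliaryField_criteria` (§ 4);
* § 3 **the heart keeps its image on `Γ_{F'}`** for ANY quadratic `F'/K` in which `disc f` is not a square
  (`range_rbar_comp_absGaloisRestrict`): `r̄_f^B` factors through `Γ_K ↠ Sym(Roots f) ≅ S₄`
  (`range_toPermHom_eq_top`, `exists_rbar_eq_comp_toPermHom` of …ThorneRbarAdequate); `Gal(K̄/F')` has
  index `2` in `Γ_K` (`isOpen_range_absGaloisRestrict_and_index_eq_two`), so its image has index `≤ 2`, and
  index `2` would make it `A₄` (Mathlib `Equiv.Perm.eq_alternatingGroup_of_index_eq_two`), i.e. the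
  Vandermonde `δ = ∏_{i<j}(αⱼ - αᵢ)` fixed by `Gal(K̄/e(F'))` (`exists_mem_range_absGaloisRestrict_iff`), i.e.
  `δ ∈ e(F')` (infinite Galois theory, `InfiniteGalois.fixedField_fixingSubgroup`), i.e. `disc f ∈ F'²`.
-/

set_option linter.dupNamespace false -- `Summit.Langlands.Langlands.…` is the problem's namespace

namespace Summit.Langlands.Langlands.Cruxes.MuOrdinaryFamilyRT.ThorneMinimalLift

open scoped NumberField Polynomial Matrix Classical
open Field IsDedekindDomain Polynomial NumberField
open Literature.NumberTheory.GaloisRepresentations Literature.NumberTheory.Automorphic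
open Literature.NumberTheory.GaloisRepresentations.QuadraticFamily
open Summit.Langlands.Langlands.Cruxes.MuOrdinaryFamilyRT.CharZeroDominance
open Summit.Langlands.Langlands.Theorems.ResidualAutomorphyEven (prodPairs prodPairs_comp_perm map_prodPairs
  discr_map_of_injective)

noncomputable section

/-! ## 1. Two generators with coprime discriminants kill the relative different -/

/-- In a quadratic extension `E/F`, an element outside `F` generates: `F[x] = E`. -/
theorem adjoin_eq_top_of_not_mem_range {F E : Type*} [Field F] [Field E] [Algebra F E]
    (h2 : Module.finrank F E = 2) {x : E} (hx : x ∉ Set.range (algebraMap F E)) :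
    Algebra.adjoin F {x} = ⊤ := by
  haveI : FiniteDimensional F E := Module.finite_of_finrank_eq_succ h2
  have hint : IsIntegral F x := Algebra.IsIntegral.isIntegral x
  have hdeg : (minpoly F x).natDegree = Module.finrank F E := by
    refine le_antisymm (minpoly.natDegree_le x) ?_
    rw [h2]
    exact (minpoly.two_le_natDegree_iff hint).mpr hx
  have htop : IntermediateField.adjoin F {x} = ⊤ :=
    (Field.primitive_element_iff_minpoly_natDegree_eq F x).mpr hdeg
  rw [← IntermediateField.adjoin_simple_toSubalgebra_of_isAlgebraic hint.isAlgebraic, htop,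
    IntermediateField.top_toSubalgebra]

/-- If `g(x) = 0` for a generator `x ∈ 𝓞 E` of `E/F` and `g ∈ 𝓞 F[X]`, then `g'(x) ∈ 𝔇(𝓞 E/𝓞 F)` (the
minimal polynomial of `x` divides `g`; Mathlib `aeval_derivative_mem_differentIdeal`). -/
theorem aeval_derivative_mem_differentIdeal_of_aeval_eq_zero {F E : Type*} [Field F] [NumberField F]
    [Field E] [NumberField E] [Algebra F E] {x : 𝓞 E} (hgen : Algebra.adjoin F {(x : E)} = ⊤)
    {g : (𝓞 F)[X]} (hg : aeval x g = 0) :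
    aeval x (derivative g) ∈ differentIdeal (𝓞 F) (𝓞 E) := by
  -- adapted from Literature/NumberTheory/NumberFields/SqrtGeneratorUnramified.lean (`isUnramifiedAt_of_sq_eq`)
  have hD := aeval_derivative_mem_differentIdeal (𝓞 F) F E x hgen
  obtain ⟨h, hh⟩ := minpoly.isIntegrallyClosed_dvd (Algebra.IsIntegral.isIntegral x) hg
  have hder : aeval x (derivative g) = aeval x (derivative (minpoly (𝓞 F) x)) * aeval x h := by
    conv_lhs => rw [hh]
    rw [derivative_mul, map_add, map_mul, map_mul, minpoly.aeval, zero_mul, add_zero]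
  rw [hder]
  exact Ideal.mul_mem_right _ _ hD

/-- **Two generators with coprime discriminants.**  If `E = F(x) = F(s)` with `x² + x + 1 = 0` and
`s² = -p`, `3 ∤ p` (here: `3 ∣ p + 1`), then every prime `Q` of `𝓞 E` is unramified over `𝓞 F`: a ramified
`Q` divides the different, which contains `2x + 1` and `2s`, hence `(2x+1)² = -3` and `(2s)² = -4p`, hence
`1`. -/
theorem isUnramifiedAt_of_two_generators {F E : Type*} [Field F] [NumberField F] [Field E] [NumberField E]
    [Algebra F E] {x s : 𝓞 E} (hxgen : Algebra.adjoin F {(x : E)} = ⊤)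
    (hsgen : Algebra.adjoin F {(s : E)} = ⊤) (hx : x ^ 2 + x + 1 = 0) {p : ℕ}
    (hs : s ^ 2 = -(p : 𝓞 E)) (hp : 3 ∣ p + 1) (Q : Ideal (𝓞 E)) [Q.IsPrime] :
    Algebra.IsUnramifiedAt (𝓞 F) Q := by
  by_contra hram
  have hle : differentIdeal (𝓞 F) (𝓞 E) ≤ Q := Ideal.le_of_dvd (dvd_differentIdeal_iff.mpr hram)
  have h1 : aeval x (derivative (X ^ 2 + X + 1 : (𝓞 F)[X])) ∈ Q :=
    hle (aeval_derivative_mem_differentIdeal_of_aeval_eq_zero hxgen (by simp [hx]))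
  have h2 : aeval s (derivative (X ^ 2 + C (p : 𝓞 F) : (𝓞 F)[X])) ∈ Q :=
    hle (aeval_derivative_mem_differentIdeal_of_aeval_eq_zero hsgen (by simp [hs]))
  have h1' : aeval x (derivative (X ^ 2 + X + 1 : (𝓞 F)[X])) = 2 * x + 1 := by
    simp; norm_num
  have h2' : aeval s (derivative (X ^ 2 + C (p : 𝓞 F) : (𝓞 F)[X])) = 2 * s := by
    simp; norm_num
  rw [h1'] at h1
  rw [h2'] at h2
  have h3 : (3 : 𝓞 E) ∈ Q := by
    have hm : (2 * x + 1) * (2 * x + 1) ∈ Q := Q.mul_mem_left _ h1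
    have e : (2 * x + 1) * (2 * x + 1) = 4 * (x ^ 2 + x + 1) + (-3) := by ring
    rw [e, hx, mul_zero, zero_add] at hm
    simpa using Q.neg_mem_iff.mp (by simpa using hm)
  have h4 : (4 * p : 𝓞 E) ∈ Q := by
    have hm : (2 * s) * (2 * s) ∈ Q := Q.mul_mem_left _ h2
    have e : (2 * s) * (2 * s) = -(4 * (-(s ^ 2))) := by ring
    rw [e, hs, neg_neg] at hm
    exact Q.neg_mem_iff.mp hm
  obtain ⟨k, hk⟩ : 3 ∣ 4 * p + 1 := by omega
  have h1Q : (1 : 𝓞 E) ∈ Q := by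
    have e : (1 : 𝓞 E) = 3 * k - 4 * p := by
      have := congrArg (Nat.cast : ℕ → 𝓞 E) hk
      push_cast at this
      linear_combination this
    rw [e]
    exact Q.sub_mem (Q.mul_mem_right _ h3) h4
  exact (Ideal.IsPrime.ne_top ‹_›) ((Ideal.eq_top_iff_one _).mpr h1Q)

/-! ## 2. CM fields containing `ζ₃` and `√-p`: `F'/F'⁺` unramified everywhere, `3` split from `F'⁺` -/

section CM

variable (F' : Type) [Field F'] [NumberField F']

/-- An element `x` of a number field with `x² = -n < 0` is not real under any complex embedding; in
particular it is outside the maximal real subfield. -/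
theorem not_mem_maximalRealSubfield_of_sq_eq_neg {x : F'} {n : ℕ} (hn : n ≠ 0) (hx : x ^ 2 = -(n : F')) :
    x ∉ maximalRealSubfield F' := by
  intro h
  obtain ⟨φ⟩ := (inferInstance : Nonempty (F' →+* ℂ))
  have hz : φ x * φ x = -(n : ℂ) := by rw [← map_mul, ← sq, hx, map_neg, map_natCast]
  have hconj := PatchingFamily.conj_eq_neg_of_mul_self_eq_neg hn hz
  have hfix : star (φ x) = φ x := (mem_maximalRealSubfield_iff x).mp h φ
  have h0 : φ x = 0 := by
    have h2 : (2 : ℂ) * φ x = 0 := by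
      have : starRingEnd ℂ (φ x) = star (φ x) := rfl
      linear_combination hconj - hfix - this
    simpa using h2
  rw [h0, mul_zero] at hz
  exact hn (by exact_mod_cast (neg_eq_zero.mp hz.symm))

variable [IsCMField F']

/-- In a CM field, an element outside `F'⁺` generates `F'` over `F'⁺`. -/
theorem adjoin_maximalRealSubfield_eq_top {x : F'} (hx : x ∉ maximalRealSubfield F') :
    Algebra.adjoin (maximalRealSubfield F') {x} = ⊤ := by
  refine adjoin_eq_top_of_not_mem_range (Algebra.IsQuadraticExtension.finrank_eq_two _ F') ?_
  rintro ⟨y, rfl⟩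
  exact hx y.2

/-- **`F'/F'⁺` is unramified at every finite place** for a CM field `F'` whose integers contain `x` with
`x² + x + 1 = 0` and `s` with `s² = -p`, `3 ∣ p + 1` (§ 1 over `F'⁺`; neither generator is real). -/
theorem unramifiedOverMaximalReal_of_generators {x s : 𝓞 F'} (hx : x ^ 2 + x + 1 = 0) {p : ℕ}
    (hp0 : p ≠ 0) (hs : s ^ 2 = -(p : 𝓞 F')) (hp : 3 ∣ p + 1) : UnramifiedOverMaximalReal F' := by
  intro w
  haveI := w.isPrime
  have hxF : (x : F') ∉ maximalRealSubfield F' := by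
    intro hmem
    refine not_mem_maximalRealSubfield_of_sq_eq_neg F' (x := 2 * (x : F') + 1) (n := 3) (by norm_num)
      ?_ ?_
    · have := congrArg ((↑) : 𝓞 F' → F') hx
      push_cast at this
      linear_combination 4 * this
    · exact add_mem (mul_mem (by exact_mod_cast natCast_mem (maximalRealSubfield F') 2) hmem)
        (one_mem _)
  have hsF : (s : F') ∉ maximalRealSubfield F' :=
    not_mem_maximalRealSubfield_of_sq_eq_neg F' hp0 (by
      have := congrArg ((↑) : 𝓞 F' → F') hs
      push_cast at this
      exact this)
  haveI : Algebra.IsUnramifiedAt (𝓞 (maximalRealSubfield F')) w.asIdeal :=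
    isUnramifiedAt_of_two_generators (adjoin_maximalRealSubfield_eq_top F' hxF)
      (adjoin_maximalRealSubfield_eq_top F' hsF) hx hs hp w.asIdeal
  exact Ideal.ramificationIdx_eq_one _ _

/-- Complex conjugation negates a square root of `-n < 0`. -/
theorem complexConj_apply_eq_neg {x : F'} {n : ℕ} (hn : n ≠ 0) (hx : x ^ 2 = -(n : F')) :
    IsCMField.complexConj F' x = -x := by
  obtain ⟨φ⟩ := (inferInstance : Nonempty (F' →+* ℂ))
  apply φ.injective
  rw [IsCMField.complexEmbedding_complexConj, map_neg]
  exact PatchingFamily.conj_eq_neg_of_mul_self_eq_neg hn (by rw [← map_mul, ← sq, hx, map_neg, map_natCast])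

/-- **Every place above `3` is moved by complex conjugation** in a CM field whose integers contain `s`
with `s² = -p`, `3 ∣ p + 1`: modulo `w ∣ 3`, `s² = 1`, so `s - 1 ∈ w` or `s + 1 ∈ w`; as `c(s) = -s`,
`c • w = w` would give `s ± 1 ∈ w` as well, hence `2 ∈ w`, hence `1 = 3 - 2 ∈ w`. -/
theorem threeSplitFromMaximalReal_of_sqrt {s : 𝓞 F'} {p : ℕ} (hp0 : p ≠ 0) (hs : s ^ 2 = -(p : 𝓞 F'))
    (hp : 3 ∣ p + 1) : ThreeSplitFromMaximalReal F' := by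
  intro w h3 heq
  haveI := w.isPrime
  set c := IsCMField.complexConj F' with hcdef
  have hc : ∀ y : 𝓞 F', y ∈ w.asIdeal → c • y ∈ w.asIdeal := fun y hy => by
    have : c • y ∈ (c • w).asIdeal := by
      rw [HeightOneSpectrum.smul_asIdeal]
      exact Ideal.smul_mem_pointwise_smul_iff.mpr hy
    rwa [heq] at this
  have hcs : c (s : F') = -(s : F') := by
    exact complexConj_apply_eq_neg F' hp0 (by
      have := congrArg ((↑) : 𝓞 F' → F') hs
      push_cast at this
      exact this)
  have h3' : (3 : 𝓞 F') ∈ w.asIdeal := by simpa using h3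
  obtain ⟨k, hk⟩ := hp
  have hprod : (s - 1) * (s + 1) ∈ w.asIdeal := by
    have e : (s - 1) * (s + 1) = -(3 * k) := by
      have : ((p + 1 : ℕ) : 𝓞 F') = ((3 * k : ℕ) : 𝓞 F') := by rw [hk]
      push_cast at this
      linear_combination hs - this
    rw [e]
    exact (w.asIdeal.neg_mem_iff).mpr (Ideal.mul_mem_right _ _ h3')
  have h2 : (2 : 𝓞 F') ∈ w.asIdeal := by
    rcases Ideal.IsPrime.mem_or_mem ‹_› hprod with h | h
    · have h' := hc _ h
      have e : c • (s - 1) + (s - 1) = -2 := by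
        apply RingOfIntegers.ext
        push_cast [map_ofNat, smul_sub]
        rw [AlgEquiv.smul_def, AlgEquiv.smul_def, map_one, hcs]
        ring
      have := w.asIdeal.add_mem h' h
      rw [e] at this
      exact (w.asIdeal.neg_mem_iff).mp this
    · have h' := hc _ h
      have e : c • (s + 1) + (s + 1) = 2 := by
        apply RingOfIntegers.ext
        push_cast [map_ofNat, smul_add]
        rw [AlgEquiv.smul_def, AlgEquiv.smul_def, map_one, hcs]
        ring
      have := w.asIdeal.add_mem h' h
      rwa [e] at this
  have h1 : (1 : 𝓞 F') ∈ w.asIdeal := by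
    have e : (3 : 𝓞 F') - 2 = 1 := by norm_num
    rw [← e]
    exact w.asIdeal.sub_mem h3' h2
  exact Ideal.IsPrime.ne_top ‹_› ((Ideal.eq_top_iff_one _).mpr h1)

end CM

/-! ## 3. The heart keeps its image on `Γ_{F'}` -/

section Range

variable {f : ℤ[X]} (hgen : Generic f)
include hgen

/-- **If `Γ_{F'}` permutes the roots evenly, `disc f` is a square in `F'`.**  The Vandermonde product
`δ = ∏_{i<j}(αⱼ − αᵢ)` is then fixed by `Gal(K̄/e(F'))` (the image of `Γ_{F'} → Γ_K` is the stabiliser of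
a copy `e(F') ⊆ K̄`, `exists_mem_range_absGaloisRestrict_iff`), hence lies in `e(F')` (infinite Galois
theory of `K̄/K`), and `disc f = lc(f)⁶ δ²`. -/
theorem isSquare_discr_of_forall_restrict_sign_eq_one (F' : Type) [Field F'] [NumberField F'] [Algebra K F']
    (h : ∀ σ : absoluteGaloisGroup F',
      Equiv.Perm.sign (MulAction.toPermHom (absoluteGaloisGroup K) (Roots f) (absGaloisRestrict K F' σ)) = 1) :
    IsSquare ((f.discr : ℤ) : F') := by
  -- adapted from `isSquare_discr_of_forall_sign_eq_one` (…ThorneRbarAdequate § 2), with `Γ_K` replaced by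
  -- the image of `Γ_{F'}`
  let ε := FreeSeedSmoothRt.rootEnum hgen
  let y : Fin 4 → AlgebraicClosure K := fun i => ((ε i : Roots f) : AlgebraicClosure K)
  have hfix : ∀ σ : absoluteGaloisGroup F', absGaloisRestrict K F' σ • prodPairs y = prodPairs y := by
    intro σ
    set g := absGaloisRestrict K F' σ with hg
    set P := MulAction.toPermHom (absoluteGaloisGroup K) (Roots f) g with hP
    let π : Equiv.Perm (Fin 4) := ε.symm.permCongr P
    have hπ : Equiv.Perm.sign π = 1 := by rw [Equiv.Perm.sign_permCongr]; exact h σ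
    have hy : (MulSemiringAction.toRingHom (absoluteGaloisGroup K) (AlgebraicClosure K) g) ∘ y = y ∘ π := by
      funext i
      simp only [Function.comp_apply, MulSemiringAction.toRingHom_apply]
      change g • ((ε i : Roots f) : AlgebraicClosure K) =
        ((ε (ε.symm.permCongr P i) : Roots f) : AlgebraicClosure K)
      rw [Equiv.permCongr_apply, Equiv.symm_symm, Equiv.apply_symm_apply]
      rfl
    calc g • prodPairs y
        = MulSemiringAction.toRingHom (absoluteGaloisGroup K) (AlgebraicClosure K) g (prodPairs y) :=
          (MulSemiringAction.toRingHom_apply _ _ _ _).symm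
      _ = prodPairs ((MulSemiringAction.toRingHom (absoluteGaloisGroup K) (AlgebraicClosure K) g) ∘ y) :=
          map_prodPairs _ y
      _ = prodPairs (y ∘ π) := by rw [hy]
      _ = (Equiv.Perm.sign π : ℤ) * prodPairs y := prodPairs_comp_perm y π
      _ = prodPairs y := by rw [hπ, Units.val_one, Int.cast_one, one_mul]
  -- the image of `Γ_{F'}` is the stabiliser of `e(F')`, so `δ ∈ e(F')`
  obtain ⟨e, he⟩ := exists_mem_range_absGaloisRestrict_iff K F'
  have hN : ((absGaloisRestrict K F').range : Subgroup (absoluteGaloisGroup K)) =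
      (e.fieldRange.fixingSubgroup : Subgroup (absoluteGaloisGroup K)) := by
    ext g
    refine (he g).trans (Iff.trans ?_ (mem_fixingSubgroup_iff_forall_smul e.fieldRange g).symm)
    constructor
    · rintro h' ⟨x, ⟨k, rfl⟩⟩
      exact h' k
    · intro h' k
      exact h' ⟨e k, ⟨k, rfl⟩⟩
  have hmem : prodPairs y ∈ e.fieldRange := by
    rw [← InfiniteGalois.fixedField_fixingSubgroup e.fieldRange, IntermediateField.mem_fixedField_iff]
    intro g hg
    have hg' : (absoluteGaloisGroup.toAlgEquiv K).symm g ∈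
        ((absGaloisRestrict K F').range : Subgroup (absoluteGaloisGroup K)) := by
      rw [hN]; exact hg
    obtain ⟨σ, hσ⟩ := hg'
    have := hfix σ
    rwa [show absGaloisRestrict K F' σ = (absoluteGaloisGroup.toAlgEquiv K).symm g from hσ] at this
  obtain ⟨d, hd⟩ := e.mem_fieldRange.mp hmem
  -- `disc f = lc⁶ δ² = e((lc³ d)²)`
  have hdisc := FreeSeedSmoothRt.cast_discr_eq hgen
  refine ⟨((f.leadingCoeff : ℤ) : F') ^ 3 * d, ?_⟩
  apply e.toRingHom.injective
  change e _ = e _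
  rw [map_intCast, hdisc]
  simp only [map_mul, map_pow, map_intCast, hd]
  simp only [prodPairs]
  ring

/-- **The heart keeps its image on `Γ_{F'}`** for a quadratic `F'/K` in which `disc f` is not a square
(`disc f ∉ ℚ² ∪ -3ℚ²` makes `Γ_K ↠ Sym(Roots f)`; the image of the index-`2` subgroup `Gal(K̄/F')` has index
`≤ 2`, and index `2` would make it the alternating group, i.e. `disc f ∈ F'²`). -/
theorem range_rbar_comp_absGaloisRestrict (hD : ¬ IsSquare (f.map (Int.castRingHom ℚ)).discr)
    (hD3 : ¬ IsSquare ((-3 : ℚ) * (f.map (Int.castRingHom ℚ)).discr))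
    (F' : Type) [Field F'] [NumberField F'] [Algebra K F'] (h2 : Module.finrank K F' = 2)
    (hF' : ¬ IsSquare ((f.discr : ℤ) : F')) (B : Module.Basis (Fin 3) (ZMod 3) (Heart 3 (Roots f))) :
    ((rbar f B).comp (absGaloisRestrict K F').toMonoidHom).range = (rbar f B).range := by
  set T := MulAction.toPermHom (absoluteGaloisGroup K) (Roots f) with hT
  have htop : T.range = ⊤ := range_toPermHom_eq_top hgen hD hD3
  have hsurj : Function.Surjective T := MonoidHom.range_eq_top.mp htop
  have hN2 : (absGaloisRestrict K F').toMonoidHom.range.index = 2 :=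
    (isOpen_range_absGaloisRestrict_and_index_eq_two K F' h2).2
  have hNT : ((absGaloisRestrict K F').toMonoidHom.range).map T = ⊤ := by
    have hdvd : (((absGaloisRestrict K F').toMonoidHom.range).map T).index ∣ 2 :=
      hN2 ▸ Subgroup.index_map_dvd _ hsurj
    rcases (Nat.dvd_prime Nat.prime_two).mp hdvd with h1 | h2'
    · exact Subgroup.index_eq_one.mp h1
    · exfalso
      have hA := Equiv.Perm.eq_alternatingGroup_of_index_eq_two h2'
      refine hF' (isSquare_discr_of_forall_restrict_sign_eq_one hgen F' fun σ => ?_)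
      have hm : T (absGaloisRestrict K F' σ) ∈ ((absGaloisRestrict K F').toMonoidHom.range).map T :=
        ⟨_, ⟨σ, rfl⟩, rfl⟩
      rw [hA, Equiv.Perm.mem_alternatingGroup] at hm
      exact hm
  obtain ⟨hP, hfac⟩ := exists_rbar_eq_comp_toPermHom f B
  rw [hfac, ← hT, MonoidHom.range_comp, MonoidHom.range_comp, ← Subgroup.map_map, hNT, htop]

end Range

/-! ## 4. Registered helper -/

/-- **Criteria for the auxiliary field** (registered helper `auxiliaryField_criteria` of stub
`stub_auxiliaryCMField`): a CM field whose integers contain `x` with `x² + x + 1 = 0` and `s` with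
`s² = -p`, `p ≠ 0`, `3 ∣ p + 1`, has `F'/F'⁺` unramified at every finite place and every place above `3`
moved by complex conjugation (§ 2). -/
theorem auxiliaryField_criteria : ∀ (F' : Type) [Field F'] [NumberField F'] [NumberField.IsCMField F'] (x s : 𝓞 F') (p : ℕ), x ^ 2 + x + 1 = 0 → p ≠ 0 → s ^ 2 = -(p : 𝓞 F') → 3 ∣ p + 1 → UnramifiedOverMaximalReal F' ∧ ThreeSplitFromMaximalReal F' :=
  fun F' _ _ _ _ _ _ hx hp0 hs hp =>
    ⟨unramifiedOverMaximalReal_of_generators F' hx hp0 hs hp, threeSplitFromMaximalReal_of_sqrt F' hp0 hs hp⟩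

end

end Summit.Langlands.Langlands.Cruxes.MuOrdinaryFamilyRT.ThorneMinimalLift
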